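import Literature.AlgebraicGeometry.HodgeTheory.HodgeSectionRestrictionPairing
import Literature.AlgebraicGeometry.HodgeTheory.HodgeClassesCupPairing
import HarnessLib

/-!
# The perfect pairing on Hodge classes (6.1) in every degree from hard Lefschetz and Hodge–Riemann (proved reduction)

Family `hodge`, layer `Literature/AlgebraicGeometry/HodgeTheory`. Companion of the named fact
`hodgeClasses_cupPairing_nondegenerate d X` (file `HodgeClassesCupPairing`; Brosnan–Fang–Nie–
Pearlstein 2009, §6 display (6.1): "By Poincaré duality and the Hodge–Riemann bilinear relations,
the cup product restricts to give a perfect pairing `Hdg^k Y ⊗ Hdg^{dim Y - k} Y → ℚ`"). The file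
`HodgeSectionRestrictionPairing` proves the MIDDLE-DEGREE case (`dim X = 2n`, `k = n`) of that
sentence from a hard Lefschetz datum `Λ : HardLefschetzNFold (2n) X` carrying the Hodge–Riemann
anisotropy; this file proves the WHOLE fact — every dimension `d`, every `k + l = d` — from the
same kind of datum, so that the discharge of `hodgeClasses_cupPairing_nondegenerate d X` is reduced
to exactly the Kähler package of the hyperplane class on the summit carriers:

* a hard Lefschetz datum `Λ : HardLefschetzNFold d X` (the content of the tree's named fact
  `nonempty_hardLefschetzNFold d X`; Voisin I Thm. 6.25, Rem. 6.27, §7.1.2),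
* the HODGE–RIEMANN ANISOTROPY of its class in every even degree: for `2m + s = d` and
  `y ∈ H^{2m}(X(ℂ); ℂ)` rational of type `(m, m)` and primitive (`L^{s+1} y = 0`), `y ≠ 0` implies
  `Lˢ y ∪ y ≠ 0 ∈ H^{2d}(X(ℂ); ℂ)` — Voisin I Thm. 6.32 / §7.1.2 (ii) ("`i^{p-q-k} (-1)^{k(k-1)/2} H(α) > 0`
  for `α` non-zero of type `(p,q)`" primitive, `H(α, β) = iᵏ ∫ L^{d-k} α ∧ β̄`) specialised to
  `k = 2m`, `p = q = m`, `α` real (rational): `(-1)^m ∫ L^{d-2m} y ∪ y > 0`, rendered SIGN-FREE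
  (the tree fixes no orientation `H^{2d}(X(ℂ); ℂ) ≅ ℂ`), a consequence weaker than print,
* the independence of Hodge types from the Hodge model (`hodgePQ_independent_of_hodgeModel`,
  needed because `IsOfHodgeType` quantifies `∃` over models and the Lefschetz decomposition step
  subtracts classes; file `HodgeFiltrationModels`).

Proof (Voisin I §6.2.3, §6.3.2 and the proof of Lemma 7.26, PDF pp. 125–128, 134, 148; the
induction of `HardLefschetzNFold.exists_cup_lefschetzPow_ne_zero` made asymmetric in the degrees):
`HardLefschetzNFold.exists_hodgePartner_lefschetzPow` — for `x ∈ H^{2m}` rational of type `(m,m)`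
(in a fixed model `A`), `x ≠ 0`, and `m + r = k`, `m + e = l`, `k + l = d`, there is a rational
`(l,l)`-class `a` with `Lʳ x ∪ a ≠ 0`. Induction on `m`: write `x = x₀ + Lβ` with `x₀` primitive,
`L^{r+e+1} x₀ = L^{d-2m+1} x₀ = 0` (`HardLefschetzNFold.exists_eq_primitive_add_lefschetzOperator`);
if `x₀ ≠ 0` the partner is `a = Lᵉ x₀`: the cross term `L^{r+1} β ∪ Lᵉ x₀ = β ∪ L^{r+e+1} x₀`
vanishes (orthogonality of the Lefschetz pieces, Voisin I Lemma 6.31) and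
`Lʳ x₀ ∪ Lᵉ x₀ = x₀ ∪ L^{r+e} x₀ = L^{d-2m} x₀ ∪ x₀ ≠ 0` by Hodge–Riemann; if `x₀ = 0` then
`Lʳ x = L^{r+1} β` and the induction hypothesis applies to `β ≠ 0` (with `e + 1`). Base `m = 0`:
every class of `H⁰` is primitive since `H^{2d+2}(X(ℂ); ℂ) = 0`
(`Motives.ComplexPoints.subsingleton_singularCohomology_of_lt`). Then
`HardLefschetzNFold.hodgeClasses_cupPairing_nondegenerate_of_hodgeRiemann`: for `c ∈ Hdg^k`,
`k ≤ l`, take `m = k`, `r = 0`; for `k > l` descend `c = L^{k-l} c₀`, `c₀ ∈ Hdg^l` rational of type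
`(l,l)` by hard Lefschetz over `ℚ` (`Λ.exists_hdg_preimage`), and take `m = l`, `r = k - l`,
`e = 0`. All cup-product algebra (`(Lⁱ u) ∪ (Lʲ v) = u ∪ (L^{i+j} v)`, graded commutativity in even
degrees) is the tree's (`cupProduct_lefschetzPowTo_lefschetzPowTo`, `cupProduct_gradedComm_holds`).

No named fact is introduced (D-0026); `hodgeClasses_cupPairing_nondegenerate` is not discharged
here (the datum with its anisotropy is a hypothesis). For `d = 2n` the anisotropy hypothesis of
this file (`2m + s = 2n`, so `s = 2r`: `L^{2r} y ∪ y ≠ 0`) is equivalent to that of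
`HardLefschetzNFold.exists_cup_lefschetzPow_ne_zero` (`Lʳ y ∪ Lʳ y ≠ 0`) by the same cup algebra.

## References

* [BrosnanFangNiePearlstein2009] P. Brosnan, H. Fang, Z. Nie, G. Pearlstein, Singularities of
  admissible normal functions, Invent. Math. 177 (2009) 599–629, §6 display (6.1)
  (arXiv:0711.0964, p. 13).
* [VoisinHodgeI2002] C. Voisin, Hodge Theory and Complex Algebraic Geometry I (CUP 2002), §6.2.3
  Prop. 6.22, Thm. 6.25, Cor. 6.26, Rem. 6.27 (PDF pp. 125–126); §6.3.2 Lemma 6.31, Thm. 6.32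
  (PDF p. 128); §7.1.2 (i)–(ii) (PDF p. 134); proof of Lemma 7.26 (PDF p. 148).
* [HatcherAT2002] A. Hatcher, Algebraic Topology (CUP 2002), §3.2 p. 211, Thm. 3.11.
-/

noncomputable section

open CategoryTheory

namespace Literature.AlgebraicGeometry.HodgeTheory

section HodgeTheory

open Literature.AlgebraicTopology.SingularHomology Literature.Geometry.Kaehler

variable {d : ℕ} {X : Motives.SchemeOver ℂ}

/-- Graded commutativity in even first degree: `u ∪ v = v ∪ u` for `u` of even degree (the sign
`(-1)^{pq}` of Hatcher Thm. 3.11 is `1`). [cite: HatcherAT2002, Thm. 3.11] -/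
private theorem cupProduct_comm_of_even {p q s : ℕ} (hp : Even p) (h : p + q = s) (h' : q + p = s)
    (u : complexBetti X p) (v : complexBetti X q) : cupProduct h u v = cupProduct h' v u := by
  rw [cupProduct_gradedComm_holds ℂ (Motives.ComplexPoints X) h h' u v,
    Even.neg_one_pow (hp.mul_right q), one_smul]

/-- **Hodge partners along the Lefschetz decomposition, asymmetric degrees** (the induction behind
BFNP (6.1) in every degree). Let `X` be smooth projective of dimension `d` with hard Lefschetz
datum `Λ` whose class satisfies the Hodge–Riemann anisotropy on rational primitive
`(m,m)`-classes (`2m + s = d`, `L^{s+1} y = 0`, `y ≠ 0` ⟹ `Lˢ y ∪ y ≠ 0`; Voisin I Thm. 6.32,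
sign-free), fix a Hodge model `A` and grant `hodgePQ_independent_of_hodgeModel`. Then for
`x ∈ H^{2m}(X(ℂ); ℂ)` rational with `A`-type `(m, m)`, `x ≠ 0`, and `m + r = k`, `m + e = l`,
`k + l = d`, there is a rational class `a ∈ H^{2l}` of type `(l, l)` with `Lʳ x ∪ a ≠ 0` in
`H^{2d}`. (Induction on `m` through `x = x₀ + Lβ`, `x₀` primitive: partner `Lᵉ x₀` if `x₀ ≠ 0` —
cross term `β ∪ L^{r+e+1} x₀ = 0`, main term `L^{d-2m} x₀ ∪ x₀ ≠ 0` — else the induction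
hypothesis for `β`; base `m = 0`: `H⁰` is primitive as `H^{2d+2}(X(ℂ); ℂ) = 0`.)
[cite: VoisinHodgeI2002, §6.2.3 Cor. 6.26, §6.3.2 Lemma 6.31 and Thm. 6.32, proof of Lemma 7.26]
[cite: BrosnanFangNiePearlstein2009, §6 display (6.1)] -/
theorem HardLefschetzNFold.exists_hodgePartner_lefschetzPow
    (hX : Motives.IsSmoothProjective d X) (Λ : HardLefschetzNFold d X)
    (hI : hodgePQ_independent_of_hodgeModel)
    (hHR : ∀ (m s : ℕ) (hms : 2 * m + s = d) (y : complexBetti X (2 * m)), IsRationalClass y →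
      IsOfHodgeType d X (2 * m) m m y →
      Λ.L (s + 1) (2 * m) (2 * m + 2 * (s + 1)) rfl y = 0 → y ≠ 0 →
      cupProduct (show 2 * m + 2 * s + 2 * m = 2 * d by omega)
        (Λ.L s (2 * m) (2 * m + 2 * s) rfl y) y ≠ 0)
    (A : HodgeModel d X) :
    ∀ (m r e k l : ℕ) (hk : m + r = k) (hl : m + e = l) (hkl : k + l = d)
      (x : complexBetti X (2 * m)), IsRationalClass x →
      A.pullback (2 * m) x ∈ A.hodgePQ (2 * m) m m → x ≠ 0 →
      ∃ a : complexBetti X (2 * l), IsRationalClass a ∧ IsOfHodgeType d X (2 * l) l l a ∧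
        cupProduct (show 2 * k + 2 * l = 2 * d by omega) (Λ.L r (2 * m) (2 * k) (by omega) x) a ≠ 0 := by
  intro m
  induction m with
  | zero =>
    intro r e k l hk hl hkl x hxQ hxA hx0
    obtain rfl : r = k := by omega
    obtain rfl : e = l := by omega
    -- every class of `H⁰` is primitive: `H^{2d+2}(X(ℂ); ℂ) = 0`
    have hprim : Λ.L (r + e + 1) (2 * 0) (2 * 0 + 2 * (r + e + 1)) rfl x = 0 := by
      haveI := Motives.ComplexPoints.subsingleton_singularCohomology_of_lt hX ℂ
        (k := 2 * 0 + 2 * (r + e + 1)) (by omega)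
      exact Subsingleton.elim _ _
    have hxT : IsOfHodgeType d X (2 * 0) 0 0 x := ⟨A, hxA⟩
    have hHRx := hHR 0 (r + e) (by omega) x hxQ hxT hprim hx0
    refine ⟨Λ.L e (2 * 0) (2 * e) (by omega) x, Λ.isRationalClass_L _ _ _ _ hxQ, ?_, ?_⟩
    · have := Λ.isOfHodgeType_L e (2 * 0) (2 * e) (by omega) 0 0 hxT
      simpa only [Nat.zero_add] using this
    · -- `Lʳ x ∪ Lᵉ x = x ∪ L^{r+e} x = L^{r+e} x ∪ x ≠ 0`
      simp only [HardLefschetzNFold.L] at hHRx ⊢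
      rw [cupProduct_lefschetzPowTo_lefschetzPowTo Λ.hyperplaneClass r e (by omega) (by omega) _
          (rfl : 2 * 0 + 2 * (r + e) = 2 * 0 + 2 * (r + e)) (by omega) x x,
        cupProduct_comm_of_even (even_two_mul 0) _ (by omega) x]
      exact hHRx
  | succ m ih =>
    intro r e k l hk hl hkl x hxQ hxA hx0
    -- the Lefschetz decomposition step: `x = x₀ + Lβ`, `L^{r+e+1} x₀ = 0`
    obtain ⟨x₀, β, hx, hprim, hQ, hT⟩ := Λ.exists_eq_primitive_add_lefschetzOperator
      (k := 2 * m) (j := r + e + 1) (l := 2 * (m + 1)) (t := 2 * (m + 1) + 2 * (r + e + 1))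
      (by omega) (by omega) rfl x
    obtain ⟨hx₀Q, hβQ⟩ := hQ hxQ
    obtain ⟨hx₀A, hβA⟩ := hT A m m hI hX hxA
    by_cases hx₀ : x₀ = 0
    · -- `x = Lβ`, `β ≠ 0`: induction (with `r + 1`, `e + 1`)
      subst hx₀
      rw [zero_add] at hx
      have hβ0 : β ≠ 0 := by
        rintro rfl
        exact hx0 (by rw [hx, map_zero])
      obtain ⟨a, haQ, haT, hne⟩ := ih (r + 1) (e + 1) k l (by omega) (by omega) hkl β hβQ hβA hβ0
      refine ⟨a, haQ, haT, ?_⟩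
      rw [hx]
      simp only [HardLefschetzNFold.L] at hne ⊢
      rwa [lefschetzPowTo_lefschetzOperator Λ.hyperplaneClass r (by omega) (by omega) (by omega) β]
    · -- `x₀ ≠ 0`: the partner is `Lᵉ x₀`
      have hx₀T : IsOfHodgeType d X (2 * (m + 1)) (m + 1) (m + 1) x₀ := ⟨A, hx₀A⟩
      set a := Λ.L e (2 * (m + 1)) (2 * l) (by omega) x₀ with ha
      have haQ : IsRationalClass a := Λ.isRationalClass_L _ _ _ _ hx₀Q
      have haT : IsOfHodgeType d X (2 * l) l l a := by
        have := Λ.isOfHodgeType_L e (2 * (m + 1)) (2 * l) (by omega) (m + 1) (m + 1) hx₀T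
        rwa [hl] at this
      have hHRx₀ := hHR (m + 1) (r + e) (by omega) x₀ hx₀Q hx₀T hprim hx₀
      refine ⟨a, haQ, haT, ?_⟩
      -- `Lʳ x = Lʳ x₀ + L^{r+1} β`
      have hLx : Λ.L r (2 * (m + 1)) (2 * k) (by omega) x =
          Λ.L r (2 * (m + 1)) (2 * k) (by omega) x₀ + Λ.L (r + 1) (2 * m) (2 * k) (by omega) β := by
        rw [hx, map_add]
        simp only [HardLefschetzNFold.L]
        rw [lefschetzPowTo_lefschetzOperator Λ.hyperplaneClass r (by omega) (by omega) (by omega) β]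
      -- the cross term `L^{r+1} β ∪ Lᵉ x₀ = β ∪ L^{r+e+1} x₀ = 0`
      have hcross : cupProduct (show 2 * k + 2 * l = 2 * d by omega)
          (Λ.L (r + 1) (2 * m) (2 * k) (by omega) β) a = 0 := by
        rw [ha]
        simp only [HardLefschetzNFold.L] at hprim ⊢
        rw [cupProduct_lefschetzPowTo_lefschetzPowTo Λ.hyperplaneClass (r + 1) e (by omega) (by omega)
            _ (by omega : 2 * (m + 1) + 2 * (r + 1 + e) = 2 * (m + 1) + 2 * (r + e + 1))
            (by omega) β x₀,
          lefschetzPowTo_congr_exponent Λ.hyperplaneClass (by omega : r + 1 + e = r + e + 1) _ rfl x₀,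
          hprim, map_zero]
      -- the main term `Lʳ x₀ ∪ Lᵉ x₀ = x₀ ∪ L^{r+e} x₀ = L^{r+e} x₀ ∪ x₀ ≠ 0` (Hodge–Riemann)
      have hmain : cupProduct (show 2 * k + 2 * l = 2 * d by omega)
          (Λ.L r (2 * (m + 1)) (2 * k) (by omega) x₀) a ≠ 0 := by
        rw [ha]
        simp only [HardLefschetzNFold.L] at hHRx₀ ⊢
        rw [cupProduct_lefschetzPowTo_lefschetzPowTo Λ.hyperplaneClass r e (by omega) (by omega) _
            (rfl : 2 * (m + 1) + 2 * (r + e) = 2 * (m + 1) + 2 * (r + e)) (by omega) x₀ x₀,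
          cupProduct_comm_of_even (even_two_mul (m + 1)) _ (by omega) x₀]
        exact hHRx₀
      rw [hLx, map_add, LinearMap.add_apply, hcross, add_zero]
      exact hmain

/-- **BFNP (6.1) in every degree from hard Lefschetz + Hodge–Riemann**: a hard Lefschetz datum
`Λ : HardLefschetzNFold d X` whose class has the Hodge–Riemann anisotropy on rational primitive
`(m,m)`-classes (sign-free Voisin I Thm. 6.32), together with `hodgePQ_independent_of_hodgeModel`,
yields the named fact `hodgeClasses_cupPairing_nondegenerate d X`: for `k ≤ l` apply
`exists_hodgePartner_lefschetzPow` with `m = k`, `r = 0`; for `k > l` descend `c = L^{k-l} c₀` with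
`c₀` rational of type `(l,l)` by hard Lefschetz over `ℚ` (`Λ.exists_hdg_preimage`) and apply it with
`m = l`, `r = k - l`, `e = 0`. This is the template for the discharge of the fact: what remains is
the Kähler package of `[H] = c₁(𝒪_X(1))` on `X^an` (hard Lefschetz = `nonempty_hardLefschetzNFold`,
and the Hodge–Riemann relation for the same class). [cite: BrosnanFangNiePearlstein2009, §6 display (6.1)]
[cite: VoisinHodgeI2002, Thm. 6.25, Thm. 6.32, §7.1.2 (i)–(ii) and proof of Lemma 7.26] -/
theorem HardLefschetzNFold.hodgeClasses_cupPairing_nondegenerate_of_hodgeRiemann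
    (Λ : HardLefschetzNFold d X) (hI : hodgePQ_independent_of_hodgeModel)
    (hHR : ∀ (m s : ℕ) (hms : 2 * m + s = d) (y : complexBetti X (2 * m)), IsRationalClass y →
      IsOfHodgeType d X (2 * m) m m y →
      Λ.L (s + 1) (2 * m) (2 * m + 2 * (s + 1)) rfl y = 0 → y ≠ 0 →
      cupProduct (show 2 * m + 2 * s + 2 * m = 2 * d by omega)
        (Λ.L s (2 * m) (2 * m + 2 * s) rfl y) y ≠ 0) :
    hodgeClasses_cupPairing_nondegenerate d X := by
  intro hX k l s hkl hs c hc hH hne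
  obtain rfl : s = 2 * d := by omega
  rcases le_or_gt k l with hkl' | hlk
  · -- `k ≤ l`: `m = k`, `r = 0`, `e = l - k`
    obtain ⟨A, hcA⟩ := hH
    obtain ⟨e, he⟩ : ∃ e, k + e = l := ⟨l - k, by omega⟩
    exact Λ.exists_hodgePartner_lefschetzPow hX hI hHR A k 0 e k l (by omega) he hkl c hc hcA hne
  · -- `k > l`: descend `c = L^{k-l} c₀` by hard Lefschetz over `ℚ`, then `m = l`, `r = k - l`, `e = 0`
    obtain ⟨j, hj⟩ : ∃ j, l + j = k := ⟨k - l, by omega⟩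
    have hH' : IsOfHodgeType d X (2 * k) (l + j) (l + j) c := by rwa [hj]
    obtain ⟨c₀, hc₀Q, hc₀T, rfl⟩ :=
      Λ.exists_hdg_preimage (j := j) (k := 2 * l) (by omega) (2 * k) (by omega) l l c hc hH'
    obtain ⟨A, hc₀A⟩ := hc₀T
    have hc₀0 : c₀ ≠ 0 := by
      rintro rfl
      exact hne (map_zero _)
    exact Λ.exists_hodgePartner_lefschetzPow hX hI hHR A l j 0 k l hj (by omega) hkl c₀ hc₀Q hc₀A
      hc₀0

/-- **(6.1) for all smooth projective varieties from the Kähler package of the hyperplane class**: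
granted, for every smooth projective `X` of dimension `d`, a hard Lefschetz datum with the
Hodge–Riemann anisotropy (Voisin I Thm. 6.25 + Thm. 6.32 for `[H] = c₁(𝒪_X(1))`, Thm. 7.10), and
`hodgePQ_independent_of_hodgeModel`, the named fact `hodgeClasses_cupPairing_nondegenerate d X`
holds for all `(d, X)` — hence (file `HodgeSectionRestrictionOfCupPairing`) so does BFNP Lemma 50
given the triangulation theorem. [cite: BrosnanFangNiePearlstein2009, §6 display (6.1)]
[cite: VoisinHodgeI2002, Thm. 6.25, Thm. 6.32 and Thm. 7.10] -/
theorem hodgeClasses_cupPairing_nondegenerate_of_hardLefschetz_hodgeRiemann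
    (hI : hodgePQ_independent_of_hodgeModel)
    (hHLR : ∀ ⦃d : ℕ⦄ ⦃X : Motives.SchemeOver ℂ⦄, Motives.IsSmoothProjective d X →
      ∃ Λ : HardLefschetzNFold d X,
        ∀ (m s : ℕ) (hms : 2 * m + s = d) (y : complexBetti X (2 * m)), IsRationalClass y →
          IsOfHodgeType d X (2 * m) m m y →
          Λ.L (s + 1) (2 * m) (2 * m + 2 * (s + 1)) rfl y = 0 → y ≠ 0 →
          cupProduct (show 2 * m + 2 * s + 2 * m = 2 * d by omega)
            (Λ.L s (2 * m) (2 * m + 2 * s) rfl y) y ≠ 0)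
    (d : ℕ) (X : Motives.SchemeOver ℂ) : hodgeClasses_cupPairing_nondegenerate d X := by
  intro hX
  obtain ⟨Λ, hHR⟩ := hHLR hX
  exact Λ.hodgeClasses_cupPairing_nondegenerate_of_hodgeRiemann hI hHR hX

end HodgeTheory

end Literature.AlgebraicGeometry.HodgeTheory

end
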